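import Literature.LinearAlgebra.Matrix.SymplecticIntegerGeneration
import Literature.LinearAlgebra.Matrix.SymplecticCongruenceSubgroup
import HarnessLib

/-!
# `Sp_{2l}(ℤ) → Sp_{2l}(ℤ/Nℤ)` is surjective: the index of `Γ(N)` and `Γ(q)Γ(q₁) = Γ` for coprime levels

Layer `Literature/LinearAlgebra/Matrix`, namespace `Literature.LinearAlgebra.Matrix.SymplecticMatrix`; lane
`lit-hodgefound` (Track 2), seat p25, sequel of `SymplecticIntegerGeneration.lean` §7 (Andrianov–Zhuravlev
Chap. 3 Lemma 3.2 (1): every symplectic matrix over `ℤ/Nℤ` lifts to `Sp_{2l}(ℤ)`) joined to skel-4's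
`SymplecticCongruenceSubgroup.lean` (A4-39 (vii): `mapHom`, `congruenceSubgroup l N = Γ(N) = ker`, and
`index Γ(N) = #range`). Theorems only; no definition, no named fact.

* **`mapHom_intCast_zmod_surjective`** — the reduction `Sp_{2l}(ℤ) →* Sp_{2l}(ℤ/Nℤ)` (`N ≠ 0`) is surjective
  (Andrianov–Zhuravlev Chap. 3 Lemma 3.2 (1), symplectic half); `range_mapHom_intCast_zmod`;
* **`index_congruenceSubgroup_eq_card`** — "the index `μ(Γⁿ(q))` is equal to the order of the group
  `Sp_n(ℤ/qℤ)`" (p0130 L23–L24): `[Sp_{2l}(ℤ) : Γ(N)] = #Sp_{2l}(ℤ/Nℤ)`, and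
  `nonempty_quotient_congruenceSubgroup_mulEquiv` (`Sp_{2l}(ℤ)/Γ(N) ≃* Sp_{2l}(ℤ/Nℤ)`);
* **`congruenceSubgroup_inf_eq_of_coprime`** — "because `q` and `q₁` are relatively prime, we have
  `Γⁿ(q) ∩ Γⁿ(q₁) = Γⁿ(qq₁)`" (p0130 L29);
* **`exists_mem_congruenceSubgroup_mul_eq_of_coprime`**, **`congruenceSubgroup_sup_eq_top_of_coprime`** —
  Lemma 3.2 (2): "If `q` and `q₁` are relatively prime, then `Γⁿ(q)Γⁿ(q₁) = Γⁿ`" (every `g` is `a b` with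
  `a ∈ Γ(q)`, `b ∈ Γ(q₁)`), here deduced from part (1) at level `qq₁` applied to the integral matrix
  `t q₁ g + s q 1` (`s q + t q₁ = 1`), which is `≡ g (mod q)` and `≡ 1 (mod q₁)`;
* **`index_congruenceSubgroup_mul_of_coprime`** — "the indices are multiplicative:
  `μ(Γⁿ(qq₁)) = μ(Γⁿ(q)) μ(Γⁿ(q₁))` if `(q, q₁) = 1`" (p0130 L27–L28).

## References

* [AndrianovZhuravlev2015] A. N. Andrianov, V. G. Zhuravlev, *Modular Forms and Hecke Operators*, Transl.
  Math. Monogr. 145, AMS (1995; reprint 2015), Chap. 3 §3.1 Lemma 3.2 and its proof (held copy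
  `book:andrianov2015-modular-forms-hecke-operators`, p0129–p0130).
* [Margulis1991] G. A. Margulis, *Discrete Subgroups of Semisimple Lie Groups* (1991), Chap. I (3.1.1)
  (congruence subgroups; the vocabulary of `SymplecticCongruenceSubgroup.lean`).
-/

open Matrix
open Literature.RepresentationTheory.HeisenbergGroup.SymplecticMatrix

namespace Literature.LinearAlgebra.Matrix.SymplecticMatrix

variable {l : Type*} [DecidableEq l] [Fintype l]

/-! ## §1. Surjectivity of the reduction and the index of `Γ(N)` -/

section Surjective

/-- **Andrianov–Zhuravlev Chap. 3 Lemma 3.2 (1) (symplectic half): the reduction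
`Sp_{2l}(ℤ) →* Sp_{2l}(ℤ/Nℤ)` is surjective** (`N ≠ 0`). [cite: AndrianovZhuravlev2015, Chap. 3 Lemma 3.2 (1)] -/
theorem mapHom_intCast_zmod_surjective (N : ℕ) [NeZero N] :
    Function.Surjective (mapHom (l := l) (Int.castRingHom (ZMod N))) := fun M => by
  obtain ⟨g, hg⟩ := exists_symplecticGroup_map_intCast_eq N M
  exact ⟨g, Subtype.ext (by rw [coe_mapHom, hg])⟩

/-- The image of the reduction modulo `N ≠ 0` is all of `Sp_{2l}(ℤ/Nℤ)`.
[cite: AndrianovZhuravlev2015, Chap. 3 Lemma 3.2 (1)] -/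
theorem range_mapHom_intCast_zmod (N : ℕ) [NeZero N] :
    (mapHom (l := l) (Int.castRingHom (ZMod N))).range = ⊤ :=
  MonoidHom.range_eq_top.2 (mapHom_intCast_zmod_surjective N)

/-- **"The index `μ(Γⁿ(q))` is equal to the order of the group `Sp_n(ℤ/qℤ)`"**:
`[Sp_{2l}(ℤ) : Γ(N)] = #Sp_{2l}(ℤ/Nℤ)` for `N ≠ 0`. [cite: AndrianovZhuravlev2015, Chap. 3 Lemma 3.2 (proof, second part)] -/
theorem index_congruenceSubgroup_eq_card (N : ℕ) [NeZero N] :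
    (congruenceSubgroup l N).index = Nat.card (Matrix.symplecticGroup l (ZMod N)) := by
  rw [index_congruenceSubgroup, range_mapHom_intCast_zmod, Subgroup.card_top]

/-- `Sp_{2l}(ℤ)/Γ(N) ≅ Sp_{2l}(ℤ/Nℤ)` (`N ≠ 0`), the first isomorphism theorem for the surjective reduction.
[cite: AndrianovZhuravlev2015, Chap. 3 Lemma 3.2 (1)] -/
theorem nonempty_quotient_congruenceSubgroup_mulEquiv (N : ℕ) [NeZero N] :
    Nonempty (Matrix.symplecticGroup l ℤ ⧸ congruenceSubgroup l N ≃* Matrix.symplecticGroup l (ZMod N)) :=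
  ⟨QuotientGroup.quotientKerEquivOfSurjective _ (mapHom_intCast_zmod_surjective N)⟩

end Surjective

/-! ## §2. Coprime levels: `Γ(q) ∩ Γ(q₁) = Γ(qq₁)` and `Γ(q)Γ(q₁) = Γ` -/

section Coprime

omit [DecidableEq l] [Fintype l] in
/-- Two integral matrices have the same reduction modulo `N` iff they are congruent entrywise. [folklore] -/
private theorem map_intCast_eq_map_intCast_iff {N : ℕ} {A B : Matrix (l ⊕ l) (l ⊕ l) ℤ} :
    A.map (Int.castRingHom (ZMod N)) = B.map (Int.castRingHom (ZMod N)) ↔ ∀ i j, A i j ≡ B i j [ZMOD N] := by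
  rw [← Matrix.ext_iff]
  refine forall_congr' fun i => forall_congr' fun j => ?_
  rw [map_apply, map_apply, eq_intCast, eq_intCast, ZMod.intCast_eq_intCast_iff]

/-- Reduction modulo `N` of `ᵗA J A`. [folklore] -/
private theorem map_transpose_mul_J_mul {N : ℕ} (A : Matrix (l ⊕ l) (l ⊕ l) ℤ) :
    (Aᵀ * Matrix.J l ℤ * A).map (Int.castRingHom (ZMod N)) =
      (A.map (Int.castRingHom (ZMod N)))ᵀ * Matrix.J l (ZMod N) * A.map (Int.castRingHom (ZMod N)) := by
  rw [Matrix.map_mul, Matrix.map_mul, transpose_map, Matrix.map_J]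

/-- **"Because `q` and `q₁` are relatively prime, we have `Γⁿ(q) ∩ Γⁿ(q₁) = Γⁿ(qq₁)`."**
[cite: AndrianovZhuravlev2015, Chap. 3 Lemma 3.2 (proof)] -/
theorem congruenceSubgroup_inf_eq_of_coprime {q q₁ : ℕ} (h : q.Coprime q₁) :
    congruenceSubgroup l q ⊓ congruenceSubgroup l q₁ = congruenceSubgroup l (q * q₁) := by
  ext M
  rw [Subgroup.mem_inf, mem_congruenceSubgroup_iff, mem_congruenceSubgroup_iff, mem_congruenceSubgroup_iff]
  refine ⟨fun hM i j => ?_, fun hM => ⟨fun i j => ?_, fun i j => ?_⟩⟩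
  · have h1 := hM.1 i j
    have h2 := hM.2 i j
    rw [Int.natCast_dvd] at h1 h2 ⊢
    exact h.mul_dvd_of_dvd_of_dvd h1 h2
  · exact dvd_trans (Int.natCast_dvd_natCast.2 (Dvd.intro _ rfl)) (hM i j)
  · exact dvd_trans (Int.natCast_dvd_natCast.2 (Dvd.intro_left _ rfl)) (hM i j)

/-- **Andrianov–Zhuravlev Chap. 3 Lemma 3.2 (2): `Γⁿ(q)Γⁿ(q₁) = Γⁿ` for coprime `q, q₁`** — every
`g ∈ Sp_{2l}(ℤ)` is `a b` with `a ∈ Γ(q)`, `b ∈ Γ(q₁)`. Proof: with `s q + t q₁ = 1` the integral matrix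
`M = t q₁ g + s q 1` is `≡ g (mod q)` and `≡ 1 (mod q₁)`, hence `ᵗMJM ≡ J (mod qq₁)`; by part (1)
(`exists_symplecticGroup_intModEq`) `M ≡ b (mod qq₁)` for some `b ∈ Sp_{2l}(ℤ)`, and then `b ∈ Γ(q₁)`,
`a = g b⁻¹ ∈ Γ(q)`. [cite: AndrianovZhuravlev2015, Chap. 3 Lemma 3.2 (2)] -/
theorem exists_mem_congruenceSubgroup_mul_eq_of_coprime {q q₁ : ℕ} (h : q.Coprime q₁)
    (g : Matrix.symplecticGroup l ℤ) :
    ∃ a ∈ congruenceSubgroup l q, ∃ b ∈ congruenceSubgroup l q₁, g = a * b := by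
  obtain ⟨s, t, hst⟩ : IsCoprime (q : ℤ) (q₁ : ℤ) := Nat.isCoprime_iff_coprime.2 h
  set G := (g : Matrix (l ⊕ l) (l ⊕ l) ℤ) with hG
  -- the CRT matrix `M = t q₁ g + s q 1`
  set M : Matrix (l ⊕ l) (l ⊕ l) ℤ := (t * q₁) • G + (s * q) • (1 : Matrix (l ⊕ l) (l ⊕ l) ℤ) with hM
  have hMij : ∀ i j, M i j = t * q₁ * G i j + s * q * (1 : Matrix (l ⊕ l) (l ⊕ l) ℤ) i j := fun i j => by
    rw [hM, Matrix.add_apply, Matrix.smul_apply, Matrix.smul_apply, smul_eq_mul, smul_eq_mul]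
  have hMq : ∀ i j, M i j ≡ G i j [ZMOD q] := fun i j => by
    have hs : s * q ≡ 0 [ZMOD q] := Int.modEq_zero_iff_dvd.2 (dvd_mul_left _ _)
    have ht : t * q₁ ≡ 1 [ZMOD q] := by
      rw [eq_sub_of_add_eq' hst]
      simpa using (Int.ModEq.refl (1 : ℤ)).sub hs
    have := (ht.mul_right (G i j)).add (hs.mul_right ((1 : Matrix (l ⊕ l) (l ⊕ l) ℤ) i j))
    rw [one_mul, zero_mul, add_zero] at this
    rwa [hMij]
  have hMq₁ : ∀ i j, M i j ≡ (1 : Matrix (l ⊕ l) (l ⊕ l) ℤ) i j [ZMOD q₁] := fun i j => by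
    have ht : t * q₁ ≡ 0 [ZMOD q₁] := Int.modEq_zero_iff_dvd.2 (dvd_mul_left _ _)
    have hs : s * q ≡ 1 [ZMOD q₁] := by
      rw [eq_sub_of_add_eq hst]
      simpa using (Int.ModEq.refl (1 : ℤ)).sub ht
    have := (ht.mul_right (G i j)).add (hs.mul_right ((1 : Matrix (l ⊕ l) (l ⊕ l) ℤ) i j))
    rw [zero_mul, one_mul, zero_add] at this
    rwa [hMij]
  -- `ᵗMJM ≡ J` modulo `q` and modulo `q₁`, hence modulo `qq₁`
  have hcongr : ∀ (N : ℕ) (A B : Matrix (l ⊕ l) (l ⊕ l) ℤ), (∀ i j, A i j ≡ B i j [ZMOD N]) →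
      ∀ i j, (Aᵀ * Matrix.J l ℤ * A) i j ≡ (Bᵀ * Matrix.J l ℤ * B) i j [ZMOD N] :=
    fun N A B hAB => map_intCast_eq_map_intCast_iff.1 (by
      rw [map_transpose_mul_J_mul, map_transpose_mul_J_mul, map_intCast_eq_map_intCast_iff.2 hAB])
  have hGsp : Gᵀ * Matrix.J l ℤ * G = Matrix.J l ℤ := SymplecticGroup.mem_iff'.1 g.2
  have h1sp : (1 : Matrix (l ⊕ l) (l ⊕ l) ℤ)ᵀ * Matrix.J l ℤ * 1 = Matrix.J l ℤ := by
    rw [transpose_one, Matrix.one_mul, Matrix.mul_one]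
  have hMsp : ∀ i j, (Mᵀ * Matrix.J l ℤ * M) i j ≡ Matrix.J l ℤ i j [ZMOD (q * q₁ : ℕ)] := fun i j => by
    rw [Nat.cast_mul]
    refine (Int.modEq_and_modEq_iff_modEq_mul (by simpa using h)).1 ⟨?_, ?_⟩
    · have := hcongr q M G hMq i j
      rwa [hGsp] at this
    · have := hcongr q₁ M 1 hMq₁ i j
      rwa [h1sp] at this
  -- part (1) at level `qq₁`
  obtain ⟨b, hb⟩ := exists_symplecticGroup_intModEq (q * q₁) M hMsp
  have hbq₁ : b ∈ congruenceSubgroup l q₁ := by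
    rw [mem_congruenceSubgroup_iff]
    intro i j
    rw [Matrix.sub_apply, ← Int.modEq_iff_dvd]
    have h1 : M i j ≡ (b : Matrix (l ⊕ l) (l ⊕ l) ℤ) i j [ZMOD q₁] :=
      Int.ModEq.of_mul_left q (by rw [← Nat.cast_mul]; exact hb i j)
    exact (hMq₁ i j).symm.trans h1
  have haq : g * b⁻¹ ∈ congruenceSubgroup l q := by
    rw [mem_congruenceSubgroup_iff_map, Submonoid.coe_mul, Matrix.map_mul]
    have hgb : G.map (Int.castRingHom (ZMod q)) = (b : Matrix (l ⊕ l) (l ⊕ l) ℤ).map (Int.castRingHom (ZMod q)) := by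
      ext i j
      rw [map_apply, map_apply, eq_intCast, eq_intCast]
      have h1 : M i j ≡ (b : Matrix (l ⊕ l) (l ⊕ l) ℤ) i j [ZMOD q] :=
        Int.ModEq.of_mul_right q₁ (by rw [← Nat.cast_mul]; exact hb i j)
      exact (ZMod.intCast_eq_intCast_iff _ _ _).2 ((hMq i j).symm.trans h1)
    rw [← hG, hgb, ← Matrix.map_mul, ← Submonoid.coe_mul, mul_inv_cancel, OneMemClass.coe_one,
      Matrix.map_one _ (map_zero _) (map_one _)]
  exact ⟨g * b⁻¹, haq, b, hbq₁, by rw [inv_mul_cancel_right]⟩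

/-- **Lemma 3.2 (2) as a statement about subgroups: `Γ(q) ⊔ Γ(q₁) = Sp_{2l}(ℤ)` for coprime `q, q₁`.**
[cite: AndrianovZhuravlev2015, Chap. 3 Lemma 3.2 (2)] -/
theorem congruenceSubgroup_sup_eq_top_of_coprime {q q₁ : ℕ} (h : q.Coprime q₁) :
    congruenceSubgroup l q ⊔ congruenceSubgroup l q₁ = ⊤ := by
  rw [eq_top_iff]
  rintro g -
  obtain ⟨a, ha, b, hb, rfl⟩ := exists_mem_congruenceSubgroup_mul_eq_of_coprime h g
  exact Subgroup.mul_mem _ (Subgroup.mem_sup_left ha) (Subgroup.mem_sup_right hb)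

/-- **"The indices are multiplicative: `μ(Γⁿ(qq₁)) = μ(Γⁿ(q)) μ(Γⁿ(q₁))` if `(q, q₁) = 1`."**
[cite: AndrianovZhuravlev2015, Chap. 3 Lemma 3.2 (proof)] -/
theorem index_congruenceSubgroup_mul_of_coprime {q q₁ : ℕ} (h : q.Coprime q₁) :
    (congruenceSubgroup l (q * q₁)).index = (congruenceSubgroup l q).index * (congruenceSubgroup l q₁).index := by
  rw [← congruenceSubgroup_inf_eq_of_coprime h,
    ← Subgroup.relIndex_mul_index (inf_le_left : congruenceSubgroup l q ⊓ congruenceSubgroup l q₁ ≤ _),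
    Subgroup.inf_relIndex_left, ← Subgroup.relIndex_sup_right, congruenceSubgroup_sup_eq_top_of_coprime h,
    Subgroup.relIndex_top_right, mul_comm]

end Coprime

end Literature.LinearAlgebra.Matrix.SymplecticMatrix
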